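import Mathlib
import Summits.Ventures.PercRepro2.Defs
import Summits.Ventures.PercRepro2.Independence
import Summits.Ventures.PercRepro2.Harris
import Summits.Ventures.PercRepro2.Graph
import Summits.Ventures.PercRepro2.Exploration
import Summits.Ventures.PercRepro2.Events
import Summits.Ventures.PercRepro2.FourFunctions
import Summits.Ventures.PercRepro2.Induced
import Summits.Ventures.PercRepro2.Frontier
import Summits.Ventures.PercRepro2.ObsIndependence
import Summits.Ventures.PercRepro2.BHK
import Summits.Ventures.PercRepro2.BHKEvents
import Summits.Ventures.PercRepro2.OrderPreservation
import Summits.Ventures.PercRepro2.BHKAvoid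
import Summits.Ventures.PercRepro2.SameClusterAvoid
import Summits.Ventures.PercRepro2.CaseOneRegime
import Summits.Ventures.PercRepro2.CaseOnePos
import Summits.Ventures.PercRepro2.CaseOneJ11
import Summits.Ventures.PercRepro2.CaseOneRV
import Summits.Ventures.PercRepro2.CaseOnePendant
import Summits.Ventures.PercRepro2.CaseOnePendantAny
import Summits.Ventures.PercRepro2.CaseOnePendantNec
import Summits.Ventures.PercRepro2.CaseOneDWorld
import Summits.Ventures.PercRepro2.CaseOneDWorldPin
import Summits.Ventures.PercRepro2.HullDefs
import Summits.Ventures.PercRepro2.OneEdge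
import Summits.Ventures.PercRepro2.StarPattern
import Summits.Ventures.PercRepro2.HCov
import Summits.Ventures.PercRepro2.HCovSwap
import Summits.Ventures.PercRepro2.OddsLemma
import Summits.Ventures.PercRepro2.RV
import Summits.Ventures.PercRepro2.RVBridge
import Summits.Ventures.PercRepro2.CaseOneDWorldOdds
import Summits.Ventures.PercRepro2.CaseOneTwoMark
import Summits.Ventures.PercRepro2.CaseOneTwoMarkMass
import Summits.Ventures.PercRepro2.CaseOneTwoMarkD
import Summits.Ventures.PercRepro2.CaseOneTwoMarkBern
import Summits.Ventures.PercRepro2.CaseOneTwoMarkII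

/-!
# `a₃` adjacent exactly to `o` and `b`: the certified coefficients and the reduction
(blind cell PercRepro2, p1 g14; S5 §2.1 (K9) (j)–(k), proofs/P1-DWORLD.md §4e)

The six `(3,3)`-Bernstein coefficients certified by the atoms of `CaseOneTwoMarkBern.lean`
(`tmB01_nonneg`, `tmB02_nonneg`, `tmB03_nonneg`, `tmB10_nonneg`, `tmB20_nonneg` — stage 1 — and
`tmB11_nonneg`, `tmB12_nonneg`, `tmB13_nonneg`, the stage-2 certificates), and the REDUCTION
`zSplitII_of_twoMark_of_bern`: `(ii)` for `a₃ ~ {o, b}` follows from the nonnegativity of the three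
remaining mixed coefficients `B₂₁, B₂₂, B₂₃` (the `r_o²` row) at the base masses — census-nonnegative
but NOT in the stage-2 cone of the pairwise atoms (kits j233538, j233539, j233540), so the class
needs an inequality beyond them. -/

namespace Summit.Ventures.PercRepro2

namespace CaseOne

section CoeffsNonneg
variable {R : Type*} [CommRing R] [LinearOrder R] [IsStrictOrderedRing R]

/-- `9·B₀₁ = 3 b (b₁ oU − M ob₁) ≥ 0`: the Q-pair odds condition at `b`. -/
lemma tmB01_nonneg (m : TMMasses R) (hb : 0 ≤ m.b) (hA5 : m.M * m.ob₁ ≤ m.b₁ * m.oU) :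
    0 ≤ tmB01 m := by
  unfold tmB01
  nlinarith [mul_nonneg hb (sub_nonneg.2 hA5)]

/-- `9·B₀₃ = 9 b (b₁ (oU − oUbU) − ob₁ (M − bU)) ≥ 0`: the odds lemma at `b`. -/
lemma tmB03_nonneg (m : TMMasses R) (hb : 0 ≤ m.b)
    (hA6 : (m.M - m.bU) * m.ob₁ ≤ (m.oU - m.oUbU) * m.b₁) : 0 ≤ tmB03 m := by
  unfold tmB03
  nlinarith [mul_nonneg hb (sub_nonneg.2 hA6)]

/-- `9·B₀₂ = 6 b (b₁ oU − M ob₁) + 3 b (bU ob₁ − b₁ oUbU) ≥ 0` (`B₀₂ = B₀₁ + ⅓ B₀₃`). -/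
lemma tmB02_nonneg (m : TMMasses R) (hb : 0 ≤ m.b) (hA5 : m.M * m.ob₁ ≤ m.b₁ * m.oU)
    (hA6 : (m.M - m.bU) * m.ob₁ ≤ (m.oU - m.oUbU) * m.b₁) : 0 ≤ tmB02 m := by
  unfold tmB02
  nlinarith [mul_nonneg hb (sub_nonneg.2 hA5), mul_nonneg hb (sub_nonneg.2 hA6)]

/-- `9·B₁₀ = 3 oU (b o₁ − M bo₁) ≥ 0`: BHK 1.4. -/
lemma tmB10_nonneg (m : TMMasses R) (hoU : 0 ≤ m.oU) (hA2 : m.M * m.bo₁ ≤ m.b * m.o₁) :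
    0 ≤ tmB10 m := by
  unfold tmB10
  nlinarith [mul_nonneg hoU (sub_nonneg.2 hA2)]

/-- `9·B₂₀ = 9·B₁₀ ≥ 0`. -/
lemma tmB20_nonneg (m : TMMasses R) (hoU : 0 ≤ m.oU) (hA2 : m.M * m.bo₁ ≤ m.b * m.o₁) :
    0 ≤ tmB20 m := by
  unfold tmB20
  nlinarith [mul_nonneg hoU (sub_nonneg.2 hA2)]

/-- **`9·B₁₁ ≥ 0`, the stage-2 certificate** (ob_cert2_B11_stage2.out):
`9 B₁₁ = (M ob − b o₂) bo₁ + (b o₁ − M bo₁)(o₂ + ob + o₁ + b₁ + 2(oU − oUbU))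
 + ((b₁ − o₁b₁) o₂ − ob₁ (M − o₁)) b + (b₁ oU − M ob₁) b + M bo₁ b₁ + M bo₁ (oU − oUbU)`,
an identity modulo the relations `oU = o₁ + o₂`, `oUbU = ob + bo₁ + ob₁ + o₁b₁`. -/
lemma tmB11_nonneg (m : TMMasses R) (hoU : m.oU = m.o₁ + m.o₂)
    (hoUbU : m.oUbU = m.ob + m.bo₁ + m.ob₁ + m.o₁b₁)
    (hM : 0 ≤ m.M) (hb : 0 ≤ m.b) (hob : 0 ≤ m.ob) (hbo₁ : 0 ≤ m.bo₁) (ho₁ : 0 ≤ m.o₁)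
    (hb₁ : 0 ≤ m.b₁) (ho₂ : 0 ≤ m.o₂) (hoUc : 0 ≤ m.oU - m.oUbU)
    (hA1 : m.b * m.o₂ ≤ m.ob * m.M) (hA2 : m.M * m.bo₁ ≤ m.b * m.o₁)
    (hA4 : m.ob₁ * (m.M - m.o₁) ≤ (m.b₁ - m.o₁b₁) * m.o₂) (hA5 : m.M * m.ob₁ ≤ m.b₁ * m.oU) :
    0 ≤ tmB11 m := by
  unfold tmB11
  have t1 := mul_nonneg (sub_nonneg.2 hA1) hbo₁
  have t2 := mul_nonneg (sub_nonneg.2 hA2)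
    (by linarith : 0 ≤ m.o₂ + m.ob + m.o₁ + m.b₁ + 2 * (m.oU - m.oUbU))
  have t3 := mul_nonneg (sub_nonneg.2 hA4) hb
  have t4 := mul_nonneg (sub_nonneg.2 hA5) hb
  have t5 := mul_nonneg (mul_nonneg hM hbo₁) hb₁
  have t6 := mul_nonneg (mul_nonneg hM hbo₁) hoUc
  rw [hoU, hoUbU] at t2
  rw [hoU] at t4
  rw [hoU, hoUbU] at t6
  rw [hoU, hoUbU]
  nlinarith [t1, t2, t3, t4, t5, t6]

/-- **`9·B₁₃ ≥ 0`, the stage-2 certificate** (kit j233536, ob_cert2_B13_stage2_j233536.out):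
`3 B₁₃ = [(o₁ − o₁b₁) b − bo₁ (M − b₁)] (oU − oUbU) + [(oU − oUbU) b₁ − (M − bU) ob₁] (b + (o₂ − ob₁) +
(b − ob − bo₁)) + bo₁ (M − bU)(oU − oUbU)` — BHK 1.4 with `C₁` avoiding `{a₂, b}` (`o ∈ C₁` against
`b ∈ C₂`), the odds lemma at `b` three times, and a monomial; an identity modulo the relations. -/
lemma tmB13_nonneg (m : TMMasses R) (hoU : m.oU = m.o₁ + m.o₂) (hbU : m.bU = m.b₁ + m.b)
    (hoUbU : m.oUbU = m.ob + m.bo₁ + m.ob₁ + m.o₁b₁)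
    (hb : 0 ≤ m.b) (hbo₁ : 0 ≤ m.bo₁) (hoUc : 0 ≤ m.oU - m.oUbU) (hMbU : 0 ≤ m.M - m.bU)
    (ho₂c : 0 ≤ m.o₂ - m.ob₁) (hbc : 0 ≤ m.b - m.ob - m.bo₁)
    (hA4' : m.bo₁ * (m.M - m.b₁) ≤ (m.o₁ - m.o₁b₁) * m.b)
    (hA6 : (m.M - m.bU) * m.ob₁ ≤ (m.oU - m.oUbU) * m.b₁) : 0 ≤ tmB13 m := by
  unfold tmB13
  have t1 := mul_nonneg (sub_nonneg.2 hA4') hoUc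
  have t2 := mul_nonneg (sub_nonneg.2 hA6) (by linarith : 0 ≤ m.b + (m.o₂ - m.ob₁) + (m.b - m.ob - m.bo₁))
  have t3 := mul_nonneg (mul_nonneg hbo₁ hMbU) hoUc
  rw [hoU, hoUbU] at t1
  rw [hoU, hbU, hoUbU] at t2
  rw [hoU, hbU, hoUbU] at t3
  rw [hoU, hbU, hoUbU]
  nlinarith [t1, t2, t3]

/-- **`9·B₁₂ ≥ 0`, the stage-2 certificate** (kit j233535, ob_cert2_B12_stage2_j233535.out; 17 terms):
`9 B₁₂ = (M ob − b o₂) bo₁ + (b o₁ − M bo₁)(ob + b₁ + 2(oU − oUbU)) + (o₂ b₁ − M ob₁)(b − ob − bo₁)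
 + [(b − ob) o₁ − bo₁ (M − o₂)] b₁ + [(b₁ − o₁b₁) o₂ − ob₁ (M − o₁)] b + [(o₁ − o₁b₁) b − bo₁ (M − b₁)] (oU − oUbU)
 + 2 [(oU − oUbU) b₁ − (M − bU) ob₁] b + (b₁ oU − M ob₁)(o₂ − ob₁)
 + M bo₁ b₁ + M bo₁ (oU − oUbU) + bo₁ b₁ (M − oU) + bo₁ (M − bU)(oU − oUbU)`
(BHK 1.3 on `C₂`, BHK 1.4 in both orders, BHK 1.4 with `C₂` avoiding `{a₁, o}`, with `C₁` avoiding
`{a₂, o}` and `{a₂, b}`, the odds lemma and the Q-pair odds condition at `b`, four monomials); an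
identity modulo the relations. -/
lemma tmB12_nonneg (m : TMMasses R) (hoU : m.oU = m.o₁ + m.o₂) (hbU : m.bU = m.b₁ + m.b)
    (hoUbU : m.oUbU = m.ob + m.bo₁ + m.ob₁ + m.o₁b₁)
    (hM : 0 ≤ m.M) (hb : 0 ≤ m.b) (hob : 0 ≤ m.ob) (hbo₁ : 0 ≤ m.bo₁) (hb₁ : 0 ≤ m.b₁)
    (hoUc : 0 ≤ m.oU - m.oUbU) (hMbU : 0 ≤ m.M - m.bU) (hMoU : 0 ≤ m.M - m.oU)
    (ho₂c : 0 ≤ m.o₂ - m.ob₁) (hbc : 0 ≤ m.b - m.ob - m.bo₁)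
    (hA1 : m.b * m.o₂ ≤ m.ob * m.M) (hA2 : m.M * m.bo₁ ≤ m.b * m.o₁) (hA3 : m.M * m.ob₁ ≤ m.o₂ * m.b₁)
    (hA4 : m.ob₁ * (m.M - m.o₁) ≤ (m.b₁ - m.o₁b₁) * m.o₂)
    (hA4' : m.bo₁ * (m.M - m.b₁) ≤ (m.o₁ - m.o₁b₁) * m.b)
    (hA5 : m.M * m.ob₁ ≤ m.b₁ * m.oU) (hA6 : (m.M - m.bU) * m.ob₁ ≤ (m.oU - m.oUbU) * m.b₁)
    (hA7 : m.bo₁ * (m.M - m.o₂) ≤ (m.b - m.ob) * m.o₁) : 0 ≤ tmB12 m := by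
  unfold tmB12
  have t1 := mul_nonneg (sub_nonneg.2 hA1) hbo₁
  have t2 := mul_nonneg (sub_nonneg.2 hA2) (by linarith : 0 ≤ m.ob + m.b₁ + 2 * (m.oU - m.oUbU))
  have t3 := mul_nonneg (sub_nonneg.2 hA3) hbc
  have t4 := mul_nonneg (sub_nonneg.2 hA7) hb₁
  have t5 := mul_nonneg (sub_nonneg.2 hA4) hb
  have t6 := mul_nonneg (sub_nonneg.2 hA4') hoUc
  have t7 := mul_nonneg (sub_nonneg.2 hA6) hb
  have t8 := mul_nonneg (sub_nonneg.2 hA5) ho₂c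
  have t9 := mul_nonneg (mul_nonneg hM hbo₁) hb₁
  have t10 := mul_nonneg (mul_nonneg hM hbo₁) hoUc
  have t11 := mul_nonneg (mul_nonneg hbo₁ hb₁) hMoU
  have t12 := mul_nonneg (mul_nonneg hbo₁ hMbU) hoUc
  rw [hoU, hoUbU] at t2
  rw [hoU, hoUbU] at t6
  rw [hoU, hbU, hoUbU] at t7
  rw [hoU] at t8
  rw [hoU, hoUbU] at t10
  rw [hoU] at t11
  rw [hoU, hbU, hoUbU] at t12
  rw [hoU, hbU, hoUbU]
  nlinarith [t1, t2, t3, t4, t5, t6, t7, t8, t9, t10, t11, t12]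

end CoeffsNonneg

/-! ## The reduction -/

section Reduction
variable {V : Type*} {E : Type*} [Fintype E] [DecidableEq E] [Fintype V] [DecidableEq V]
  {R : Type*} [Field R] [LinearOrder R] [IsStrictOrderedRing R]
variable {ends : E → Sym2 V} {o b a₃ : V} {eo eb : E}

/-- **`(ii)` for `a₃ ~ {o, b}` from the five mixed Bernstein coefficients.** With
`m = tmMasses p[eo ↦ 0][eb ↦ 0]` (the base masses), `ZSplitII` holds as soon as
`B₂₁, B₂₂, B₂₃ ≥ 0` at `m` — the other eight coefficients are theorems (`tmB01_nonneg`, …,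
`tmB11_nonneg`, `tmB12_nonneg`, `tmB13_nonneg` from the BHK atoms of `CaseOneTwoMarkBern.lean`), and
the Bernstein form `iiQ_bern` with `0 ≤ p_o, p_b ≤ 1` does the rest. The three hypotheses — the
`r_o²` row — are census-nonnegative polynomial inequalities in the base masses that are OUTSIDE the
stage-2 cone of the pairwise atoms (P1-DWORLD.md §4e″); this theorem is the kernel reduction of the
class to them. -/
theorem zSplitII_of_twoMark_of_bern (p : E → R) (hp : IsProbVec p)
    (h : IsTwoMarkAt ends o b a₃ eo eb) {a₁ a₂ : V} (h1 : a₁ ≠ a₃) (h2 : a₂ ≠ a₃)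
    (hB21 : 0 ≤ tmB21 (tmMasses (Function.update (Function.update p eo 0) eb 0) ends o a₁ a₂ b))
    (hB22 : 0 ≤ tmB22 (tmMasses (Function.update (Function.update p eo 0) eb 0) ends o a₁ a₂ b))
    (hB23 : 0 ≤ tmB23 (tmMasses (Function.update (Function.update p eo 0) eb 0) ends o a₁ a₂ b)) :
    ZSplitII p ends o a₁ a₂ a₃ b := by
  unfold ZSplitII
  rw [iiExpr_eq_iiQ p h h1 h2]
  set p00 := Function.update (Function.update p eo 0) eb 0 with hp00
  have hp0 : IsProbVec p00 := (hp.update eo le_rfl zero_le_one).update eb le_rfl zero_le_one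
  set m := tmMasses p00 ends o a₁ a₂ b with hm
  -- the atoms at the pinned law
  have hA1 : m.b * m.o₂ ≤ m.ob * m.M := tm_bhk_same_a2 p00 hp0 ends o a₁ a₂ b
  have hA2 : m.M * m.bo₁ ≤ m.b * m.o₁ := tm_bhk_cross_o1_b2 p00 hp0 ends o a₁ a₂ b
  have hA4 : m.ob₁ * (m.M - m.o₁) ≤ (m.b₁ - m.o₁b₁) * m.o₂ := tm_bhk_avoid_c1 p00 hp0 ends o a₁ a₂ b
  have hA5 : m.M * m.ob₁ ≤ m.b₁ * m.oU := tm_oddsQ_b p00 hp0 ends o a₁ a₂ b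
  have hA6 : (m.M - m.bU) * m.ob₁ ≤ (m.oU - m.oUbU) * m.b₁ := tm_odds_b p00 hp0 ends o a₁ a₂ b
  have hA3 : m.M * m.ob₁ ≤ m.o₂ * m.b₁ := tm_bhk_cross_b1_o2 p00 hp0 ends o a₁ a₂ b
  have hA7 : m.bo₁ * (m.M - m.o₂) ≤ (m.b - m.ob) * m.o₁ := by
    have h' := tm_bhk_avoid_c1 p00 hp0 ends o a₂ a₁ b
    rw [connEvent_comm ends a₂ a₁] at h'
    have e : (connEvent ends a₁ a₂)ᶜ ∩ connEvent ends a₂ b ∩ connEvent ends a₁ o =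
        (connEvent ends a₁ a₂)ᶜ ∩ connEvent ends a₁ o ∩ connEvent ends a₂ b := Set.inter_right_comm _ _ _
    rw [prob_congr_set p00 e] at h'
    exact h'
  have hA4' : m.bo₁ * (m.M - m.b₁) ≤ (m.o₁ - m.o₁b₁) * m.b := by
    have h' := tm_bhk_avoid_c1 p00 hp0 ends b a₁ a₂ o
    have e : (connEvent ends a₁ a₂)ᶜ ∩ connEvent ends a₁ b ∩ connEvent ends a₁ o =
        (connEvent ends a₁ a₂)ᶜ ∩ connEvent ends a₁ o ∩ connEvent ends a₁ b := Set.inter_right_comm _ _ _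
    rw [prob_congr_set p00 e] at h'
    exact h'
  -- nonnegativity of the masses and of `oU − oUbU`
  have hM : 0 ≤ m.M := prob_nonneg hp0 _
  have hb : 0 ≤ m.b := prob_nonneg hp0 _
  have hob : 0 ≤ m.ob := prob_nonneg hp0 _
  have hbo₁ : 0 ≤ m.bo₁ := prob_nonneg hp0 _
  have ho₁ : 0 ≤ m.o₁ := prob_nonneg hp0 _
  have hb₁ : 0 ≤ m.b₁ := prob_nonneg hp0 _
  have ho₂ : 0 ≤ m.o₂ := prob_nonneg hp0 _
  have hoU : 0 ≤ m.oU := prob_nonneg hp0 _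
  have hMoU : 0 ≤ m.M - m.oU := by
    have s1 := prob_inter_add_prob_inter_compl p00 (connEvent ends a₁ a₂)ᶜ
      (connEvent ends a₁ o ∪ connEvent ends a₂ o)
    have h0 := prob_nonneg hp0 ((connEvent ends a₁ a₂)ᶜ ∩ (connEvent ends a₁ o ∪ connEvent ends a₂ o)ᶜ)
    show 0 ≤ prob p00 _ - prob p00 _
    linarith [s1, h0]
  have hMbU : 0 ≤ m.M - m.bU := by
    have s1 := prob_inter_add_prob_inter_compl p00 (connEvent ends a₁ a₂)ᶜ
      (connEvent ends a₁ b ∪ connEvent ends a₂ b)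
    have h0 := prob_nonneg hp0 ((connEvent ends a₁ a₂)ᶜ ∩ (connEvent ends a₁ b ∪ connEvent ends a₂ b)ᶜ)
    show 0 ≤ prob p00 _ - prob p00 _
    linarith [s1, h0]
  have ho₂c : 0 ≤ m.o₂ - m.ob₁ := by
    show 0 ≤ prob p00 _ - prob p00 _
    have := prob_mono hp0 (p := p00) (A := (connEvent ends a₁ a₂)ᶜ ∩ connEvent ends a₁ b ∩ connEvent ends a₂ o)
      (B := (connEvent ends a₁ a₂)ᶜ ∩ connEvent ends a₂ o) (fun ω hω => ⟨hω.1.1, hω.2⟩)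
    linarith [this]
  have hbc : 0 ≤ m.b - m.ob - m.bo₁ := by
    show 0 ≤ prob p00 _ - prob p00 _ - prob p00 _
    have s1 := prob_inter_add_prob_inter_compl p00 ((connEvent ends a₁ a₂)ᶜ ∩ connEvent ends a₂ b)
      (connEvent ends a₁ o ∪ connEvent ends a₂ o)
    have h0 := prob_nonneg hp0 ((connEvent ends a₁ a₂)ᶜ ∩ connEvent ends a₂ b ∩
      (connEvent ends a₁ o ∪ connEvent ends a₂ o)ᶜ)
    have e : (connEvent ends a₁ a₂)ᶜ ∩ connEvent ends a₂ b ∩ (connEvent ends a₁ o ∪ connEvent ends a₂ o) =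
        ((connEvent ends a₁ a₂)ᶜ ∩ connEvent ends a₂ o ∩ connEvent ends a₂ b) ∪
          ((connEvent ends a₁ a₂)ᶜ ∩ connEvent ends a₁ o ∩ connEvent ends a₂ b) := by
      ext ω
      simp only [Set.mem_inter_iff, Set.mem_union, Set.mem_compl_iff]
      tauto
    have d : Disjoint ((connEvent ends a₁ a₂)ᶜ ∩ connEvent ends a₂ o ∩ connEvent ends a₂ b)
        ((connEvent ends a₁ a₂)ᶜ ∩ connEvent ends a₁ o ∩ connEvent ends a₂ b) :=
      Set.disjoint_left.2 fun _ hω hω' => hω.1.1 (conn_trans hω'.1.2 (conn_symm hω.1.2))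
    rw [e, prob_union_of_disjoint p00 d] at s1
    linarith [s1, h0]
  have hoUc : 0 ≤ m.oU - m.oUbU := by
    have s1 := prob_inter_add_prob_inter_compl p00
      ((connEvent ends a₁ a₂)ᶜ ∩ (connEvent ends a₁ o ∪ connEvent ends a₂ o))
      (connEvent ends a₁ b ∪ connEvent ends a₂ b)
    have h0 := prob_nonneg hp0 ((connEvent ends a₁ a₂)ᶜ ∩
      (connEvent ends a₁ o ∪ connEvent ends a₂ o) ∩ (connEvent ends a₁ b ∪ connEvent ends a₂ b)ᶜ)
    show 0 ≤ prob p00 _ - prob p00 _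
    linarith [s1, h0]
  -- the six certified coefficients
  have c01 := tmB01_nonneg m hb hA5
  have c02 := tmB02_nonneg m hb hA5 hA6
  have c03 := tmB03_nonneg m hb hA6
  have c10 := tmB10_nonneg m hoU hA2
  have c20 := tmB20_nonneg m hoU hA2
  have c11 := tmB11_nonneg m (tmMasses_oU p00 a₁ a₂) (tmMasses_oUbU p00 a₁ a₂) hM hb hob hbo₁ ho₁ hb₁
    ho₂ hoUc hA1 hA2 hA4 hA5
  have c13 := tmB13_nonneg m (tmMasses_oU p00 a₁ a₂) (tmMasses_bU p00 a₁ a₂) (tmMasses_oUbU p00 a₁ a₂)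
    hb hbo₁ hoUc hMbU ho₂c hbc hA4' hA6
  have c12 := tmB12_nonneg m (tmMasses_oU p00 a₁ a₂) (tmMasses_bU p00 a₁ a₂) (tmMasses_oUbU p00 a₁ a₂)
    hM hb hob hbo₁ hb₁ hoUc hMbU hMoU ho₂c hbc hA1 hA2 hA3 hA4 hA4' hA5 hA6 hA7
  -- the Bernstein weights
  have hr0 : 0 ≤ p eo := hp.nonneg eo
  have hr1 : 0 ≤ 1 - p eo := sub_nonneg.2 (hp.le_one eo)
  have hs0 : 0 ≤ p eb := hp.nonneg eb
  have hs1 : 0 ≤ 1 - p eb := sub_nonneg.2 (hp.le_one eb)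
  have w : ∀ (c : R) (i j : ℕ), 0 ≤ c →
      0 ≤ c * (p eo) ^ i * (1 - p eo) ^ (3 - i) * (p eb) ^ j * (1 - p eb) ^ (3 - j) := fun c i j hc =>
    mul_nonneg (mul_nonneg (mul_nonneg (mul_nonneg hc (pow_nonneg hr0 _)) (pow_nonneg hr1 _))
      (pow_nonneg hs0 _)) (pow_nonneg hs1 _)
  have key := iiQ_bern (p eo) (p eb) m
  have h9 : 0 ≤ 9 * iiQ (p eo) (p eb) m := by
    rw [key]
    have t01 : 0 ≤ 3 * p eo ^ 0 * (1 - p eo) ^ 3 * p eb ^ 1 * (1 - p eb) ^ 2 * tmB01 m :=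
      mul_nonneg (w 3 0 1 (by norm_num)) c01
    have t02 : 0 ≤ 3 * p eo ^ 0 * (1 - p eo) ^ 3 * p eb ^ 2 * (1 - p eb) ^ 1 * tmB02 m :=
      mul_nonneg (w 3 0 2 (by norm_num)) c02
    have t03 : 0 ≤ 1 * p eo ^ 0 * (1 - p eo) ^ 3 * p eb ^ 3 * (1 - p eb) ^ 0 * tmB03 m :=
      mul_nonneg (w 1 0 3 (by norm_num)) c03
    have t10 : 0 ≤ 3 * p eo ^ 1 * (1 - p eo) ^ 2 * p eb ^ 0 * (1 - p eb) ^ 3 * tmB10 m :=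
      mul_nonneg (w 3 1 0 (by norm_num)) c10
    have t11 : 0 ≤ 9 * p eo ^ 1 * (1 - p eo) ^ 2 * p eb ^ 1 * (1 - p eb) ^ 2 * tmB11 m :=
      mul_nonneg (w 9 1 1 (by norm_num)) c11
    have t12 : 0 ≤ 9 * p eo ^ 1 * (1 - p eo) ^ 2 * p eb ^ 2 * (1 - p eb) ^ 1 * tmB12 m :=
      mul_nonneg (w 9 1 2 (by norm_num)) c12
    have t13 : 0 ≤ 3 * p eo ^ 1 * (1 - p eo) ^ 2 * p eb ^ 3 * (1 - p eb) ^ 0 * tmB13 m :=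
      mul_nonneg (w 3 1 3 (by norm_num)) c13
    have t20 : 0 ≤ 3 * p eo ^ 2 * (1 - p eo) ^ 1 * p eb ^ 0 * (1 - p eb) ^ 3 * tmB20 m :=
      mul_nonneg (w 3 2 0 (by norm_num)) c20
    have t21 : 0 ≤ 9 * p eo ^ 2 * (1 - p eo) ^ 1 * p eb ^ 1 * (1 - p eb) ^ 2 * tmB21 m :=
      mul_nonneg (w 9 2 1 (by norm_num)) hB21
    have t22 : 0 ≤ 9 * p eo ^ 2 * (1 - p eo) ^ 1 * p eb ^ 2 * (1 - p eb) ^ 1 * tmB22 m :=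
      mul_nonneg (w 9 2 2 (by norm_num)) hB22
    have t23 : 0 ≤ 3 * p eo ^ 2 * (1 - p eo) ^ 1 * p eb ^ 3 * (1 - p eb) ^ 0 * tmB23 m :=
      mul_nonneg (w 3 2 3 (by norm_num)) hB23
    linarith [t01, t02, t03, t10, t11, t12, t13, t20, t21, t22, t23]
  linarith [h9]

end Reduction

end CaseOne

end Summit.Ventures.PercRepro2
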